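import Summits.BirchSwinnertonDyer.BirchSwinnertonDyer.Theses.SmallImageMuTransfer
import Summits.BirchSwinnertonDyer.BirchSwinnertonDyer.Theorems.SmallImageMuTransferAnalyticMuZeroX9RhoBarInvariance
import Summits.BirchSwinnertonDyer.Rank1Residual.X10.AnomalousCongruenceInvariant
import HarnessLib

/-!
# K6 crux `AnalyticMuZeroX9` (stmt-BirchSwinnertonDyer-19630) on the CONGRUENCE-TRANSFER road, CLASS
# LEVEL: the crux is EQUIVALENT to «every X9 pair has a certified `p`-congruent partner», and the
# unit-`L`-value / trivial-partner sub-roads are structurally closed on the ANOMALOUS X9 pairs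

Cell `bsd-print-x9` (D-0131 (2) print tier), seat `bsd-print-x9-p2` (prover, gen 0; strategy sentence
«μ = 0 by congruence transport (Greenberg–Vatsal 2000 (1.4) / Emerton–Pollack–Weston 2006) + analytic
μ = 0 certificate — drive 19629/19630 to class theorems»). `--supports` helper of item 19630. HONEST
FRAMING: theorems only (no definition, no named fact, nothing asserted about any curve, nothing booked);
the class-wide crux `Rank1Residual.AnalyticMuZeroOnClassX9` = Greenberg's `μ = 0` (LNM 1716 Conj. 1.11,
analytic side) on class X9 stays OPEN. Beyond-print theorem: NO (everything here is Emerton–Pollack–Weston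
Thm. 1 + Serre §1.11 bookkeeping). Currency: crux record, not a leaf.

## What this file settles about the road, class-wide

Lane B of cell `b2b-bsdres` (`SmallImageMuTransferAnalyticMuZeroX9UnitValuePartner`, p527576) displayed
the crux BY NAME from the hypothesis «every X9 pair `(W, p)` has a NON-ANOMALOUS `p`-congruent partner
`A` with `L(A,1)/Ω_A` a `p`-adic unit». Two kernel facts decide what that display is worth:

* `dvd_frobeniusTrace_sub_one_of_torsionIso_of_classX9` — at an X9 pair, «anomalous» (`p ∣ a_p − 1`)
  passes to EVERY good-ordinary `p`-congruent partner (Serre 1972 §1.11: `a_p mod p` is read on the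
  unramified quotient of `E[p]|_{D_p}`; kernel `X10.dvd_frobeniusTrace_sub_one_iff_of_torsionIso`, x10
  g24). Hence `not_forall_exists_nonanomalousPartner_of_anomalous`: ONE anomalous X9 pair refutes the
  displayed hypothesis of p527576 (and closes the trivial-partner road U2, which needs `p ∤ #Ã(𝔽_p)`, and
  the unit-`L`-VALUE certificate, whose constant coefficient carries `(1 − α⁻¹)² ∈ pℤ_p`, on that pair).
  The cell's census (`b2b-bsdres-x9/x9_census_N500k.json`, 790 X9 pairs with `N < 5·10⁵`, `r_an ≤ 1`)
  has 119 anomalous pairs (58 + 49 of type `5S4` in ranks 0/1, 3 + 9 of type `5Ns`, 0 of type `7Ns`;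
  e.g. `648c1 @ 5`, `a_5 = 1`) — a certificate row, not a kernel fact; the kernel statement is the
  implication.
* `analyticMuZeroX9_iff_forall_exists_certifiedPartner` — the HONEST class-level form of the road:
  modulo EPW 2006 Thm. 1 (`hEPW`), the period unit (`h5`), Carayol (`hlev`) and modularity (`hmodP`),
  `Theses.SmallImageMuTransfer.AnalyticMuZeroX9` is EQUIVALENT to «every X9 pair `(W, p)` has a globally
  minimal partner `A`, good ordinary at `p`, with a `Γ_ℚ`-equivariant `A[p] ≃ W[p]`, and a newform `f_A`
  of `A` (any level) with SOME `p`-adic unit coefficient of `L_p(f_A, α_A)`» (anomalous partners and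
  `A = W` allowed; `⇐` is the transport `certificate_of_torsionIso`, koly g6; `⇒` takes `A = W`). So the
  congruence road re-indexes the crux by residual representation `ρ̄` — one exact modular-symbol
  certificate per `ρ̄` serves every X9 member — but CANNOT weaken it class-wide: the weakest honest
  displayed hypothesis on this road is the crux itself. The residual crux of the print route on this road
  is therefore stmt-19630 verbatim (with 19629 modulo Kato's package F1, and 19631 in rank 1).

References: M. Emerton, R. Pollack, T. Weston, Invent. Math. 163 (2006) Thm. 1 [EmertonPollackWeston2006];
R. Greenberg, V. Vatsal, Invent. Math. 142 (2000) §3 Rem. (3.4) [GreenbergVatsal2000]; J.-P. Serre,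
Invent. Math. 15 (1972) §1.11 [Serre1972]; B. Mazur, Invent. Math. 18 (1972) §1 (anomalous primes)
[Mazur1972]; R. Greenberg, LNM 1716 (1999) Conj. 1.11 [GreenbergLNM1716].
-/

-- the summit and its single problem are both named `BirchSwinnertonDyer` (registry layout D-0017)
set_option linter.dupNamespace false

set_option autoImplicit false

noncomputable section

open scoped Classical MatrixGroups ModularForm

open CongruenceSubgroup WeierstrassCurve Field
open Literature.NumberTheory.EllipticCurves Literature.NumberTheory.EllipticCurves.ModularForms
open Literature.NumberTheory.EllipticCurves.Rank1Residual (hasIrreducibleModPGaloisRep_of_torsionIso_symm)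

namespace Summit.BirchSwinnertonDyer.BirchSwinnertonDyer.Rank1Residual

/-! ### §1 Anomalous X9 pairs: every partner is anomalous -/

/-- **At an X9 pair, «anomalous» passes to every good-ordinary `p`-congruent partner.** For `W`
globally minimal with `ClassX9 W p` (so `p ≥ 5` is good ordinary for `W`) and `p ∣ a_p(W) − 1`, every
globally minimal `A`, good ordinary at `p`, with a `Γ_ℚ`-equivariant `A[p] ≃ W[p]` (certificate C1)
has `p ∣ a_p(A) − 1`: `a_p mod p` is the eigenvalue of Frobenius on the unramified quotient of
`E[p]|_{D_p}`, an invariant of the mod-`p` Galois module (x10 g24's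
`X10.dvd_frobeniusTrace_sub_one_iff_of_torsionIso`). [cite: Serre1972, §1.11 (1), Prop. 11 and Cor.]
[cite: Mazur1972, §1 (anomalous primes)] -/
theorem dvd_frobeniusTrace_sub_one_of_torsionIso_of_classX9
    (W A : WeierstrassCurve ℚ) [W.IsElliptic] [W.IsGloballyMinimal] [A.IsElliptic] [A.IsGloballyMinimal]
    (p : ℕ) [Fact p.Prime] (hX9 : ClassX9 W p) (hanom : (p : ℤ) ∣ W.frobeniusTrace p - 1)
    (hgoodA : A.HasGoodReductionAtPrime p) (hordA : ¬ (p : ℤ) ∣ A.frobeniusTrace p)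
    (hC1 : ∃ e : geomTorsion A (p : ℤ) ≃+ geomTorsion W (p : ℤ),
      ∀ (σ : Field.absoluteGaloisGroup ℚ) (P : geomTorsion A (p : ℤ)), e (σ • P) = σ • e P) :
    (p : ℤ) ∣ A.frobeniusTrace p - 1 := by
  obtain ⟨-, hp, hgood, hord, -, -⟩ := hX9
  have hp2 : p ≠ 2 := by omega
  exact (Summit.BirchSwinnertonDyer.Rank1Residual.X10.dvd_frobeniusTrace_sub_one_iff_of_torsionIso
    hp2 hgood hord hgoodA hordA hC1).mp hanom

/-- **Equivalently, in point-count currency**: at an anomalous X9 pair every good-ordinary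
`p`-congruent partner `A` has `p ∣ #Ã(𝔽_p)` — the hypothesis `p ∤ #Ã(𝔽_p)` of the trivial-partner
road U2 (`Rank1Residual.bsdp_of_trivialPartner_of_goodOrd`) fails for every partner.
[cite: Serre1972, §1.11 (1), Prop. 11 and Cor.] [cite: Mazur1972, §1 (anomalous primes)] -/
theorem dvd_reductionPointCount_of_torsionIso_of_classX9
    (W A : WeierstrassCurve ℚ) [W.IsElliptic] [W.IsGloballyMinimal] [A.IsElliptic] [A.IsGloballyMinimal]
    (p : ℕ) [Fact p.Prime] (hX9 : ClassX9 W p) (hanom : p ∣ W.reductionPointCount p)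
    (hgoodA : A.HasGoodReductionAtPrime p) (hordA : ¬ (p : ℤ) ∣ A.frobeniusTrace p)
    (hC1 : ∃ e : geomTorsion A (p : ℤ) ≃+ geomTorsion W (p : ℤ),
      ∀ (σ : Field.absoluteGaloisGroup ℚ) (P : geomTorsion A (p : ℤ)), e (σ • P) = σ • e P) :
    p ∣ A.reductionPointCount p := by
  obtain ⟨-, hp, hgood, hord, -, -⟩ := hX9
  have hp2 : p ≠ 2 := by omega
  exact (Summit.BirchSwinnertonDyer.Rank1Residual.X10.dvd_reductionPointCount_iff_of_torsionIso
    hp2 hgood hord hgoodA hordA hC1).mp hanom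

/-- **One anomalous X9 pair refutes the displayed hypothesis of the unit-`L`-value display**
(`analyticMuZeroX9_of_forall_exists_unitLValuePartner`, p527576): if some X9 pair `(W₀, p₀)` has
`p₀ ∣ a_{p₀}(W₀) − 1`, then NOT every X9 pair has a non-anomalous good-ordinary `p`-congruent partner
with a unit `L`-value — indeed `(W₀, p₀)` has no non-anomalous partner at all (§1). The per-pair
theorems of that file are unaffected; only its class-level display is vacuous on a census with an
anomalous pair (119 of the 790 pairs with `N < 5·10⁵`: certificate row, e.g. `648c1 @ 5`, `a_5 = 1`).
[cite: Serre1972, §1.11 (1), Prop. 11 and Cor.] [cite: Mazur1972, §1 (anomalous primes)] -/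
theorem not_forall_exists_nonanomalousPartner_of_anomalous
    (W₀ : WeierstrassCurve ℚ) [W₀.IsElliptic] [W₀.IsGloballyMinimal] (p₀ : ℕ) [Fact p₀.Prime]
    (hX9 : ClassX9 W₀ p₀) (hanom : (p₀ : ℤ) ∣ W₀.frobeniusTrace p₀ - 1) :
    ¬ (∀ (W : WeierstrassCurve ℚ) [W.IsElliptic] [W.IsGloballyMinimal] (p : ℕ) [Fact p.Prime],
      ClassX9 W p →
      ∃ (A : WeierstrassCurve ℚ) (_ : A.IsElliptic) (_ : A.IsGloballyMinimal),
        A.HasGoodReductionAtPrime p ∧ ¬ (p : ℤ) ∣ A.frobeniusTrace p ∧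
        (∃ e : geomTorsion A (p : ℤ) ≃+ geomTorsion W (p : ℤ),
          ∀ (σ : Field.absoluteGaloisGroup ℚ) (P : geomTorsion A (p : ℤ)), e (σ • P) = σ • e P) ∧
        ¬ (p : ℤ) ∣ A.frobeniusTrace p - 1 ∧
        ∃ q : ℚ, q ≠ 0 ∧ A.entireLFunction 1 / (A.realPeriodRat : ℂ) = (q : ℂ) ∧
          padicValRat p q = 0) := by
  intro h
  obtain ⟨A, _, _, hgoodA, hordA, hC1, hapA, -⟩ := h W₀ p₀ hX9
  exact hapA (dvd_frobeniusTrace_sub_one_of_torsionIso_of_classX9 W₀ A p₀ hX9 hanom hgoodA hordA hC1)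

/-! ### §2 The honest class-level form of the road: the crux ⟺ «every X9 pair has a certified partner» -/

/-- **Crux `AnalyticMuZeroX9` BY NAME from certified partners (anomalous allowed).** Granting EPW
2006 Thm. 1 (`hEPW`), the period unit (`h5`) and Carayol (`hlev`): IF every X9 pair `(W, p)` has a
globally minimal partner `A`, good ordinary at `p`, with a `Γ_ℚ`-equivariant `A[p] ≃ W[p]` and a
newform `f_A` of `A` of some level carrying ONE `p`-adic unit coefficient of `L_p(f_A, α_A)` (`A = W`
allowed, `A` anomalous allowed, any coefficient index), THEN
`Theses.SmallImageMuTransfer.AnalyticMuZeroX9`. Proof: `A[p]` is irreducible (transported from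
`W[p]`) and `certificate_of_torsionIso` (koly g6) moves the certificate to every newform of `W`.
[cite: EmertonPollackWeston2006, Thm. 1 (arXiv:math/0404484 p. 2)] [cite: GreenbergVatsal2000, §3 Remark (3.4)] -/
theorem analyticMuZeroX9_of_forall_exists_certifiedPartner
    (hEPW : EmertonPollackWeston2006.thm1_muAn_transfer_of_torsionIso)
    (h5 : realPeriodRat_eq_unit_mul_plusPeriod)
    (hlev : ∀ (N : ℕ) [NeZero N], IsNewformOf.level_eq_conductorNorm (N := N))
    (hpartner : ∀ (W : WeierstrassCurve ℚ) [W.IsElliptic] [W.IsGloballyMinimal] (p : ℕ) [Fact p.Prime],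
      ClassX9 W p →
      ∃ (A : WeierstrassCurve ℚ) (_ : A.IsElliptic) (_ : A.IsGloballyMinimal),
        A.HasGoodReductionAtPrime p ∧ ¬ (p : ℤ) ∣ A.frobeniusTrace p ∧
        (∃ e : geomTorsion A (p : ℤ) ≃+ geomTorsion W (p : ℤ),
          ∀ (σ : Field.absoluteGaloisGroup ℚ) (P : geomTorsion A (p : ℤ)), e (σ • P) = σ • e P) ∧
        ∃ (N : ℕ) (_ : NeZero N) (fA : CuspForm (Gamma0 N) 2), IsNewformOf A fA ∧
          ∃ n : ℕ, ‖PowerSeries.coeff n (padicLFunction fA (unitRoot A p : ℚ_[p]))‖ = 1) :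
    Summit.BirchSwinnertonDyer.BirchSwinnertonDyer.Theses.SmallImageMuTransfer.AnalyticMuZeroX9 := by
  unfold Summit.BirchSwinnertonDyer.BirchSwinnertonDyer.Theses.SmallImageMuTransfer.AnalyticMuZeroX9
    AnalyticMuZeroOnClassX9
  intro W _ _ p _ N _ f hX9 hf
  obtain ⟨A, _, _, hgoodA, hordA, ⟨e, he⟩, NA, _, fA, hfA, hcertA⟩ := hpartner W p hX9
  obtain ⟨-, hp, hgood, hord, hirr, -⟩ := hX9
  have hirrA : A.HasIrreducibleModPGaloisRep p := hasIrreducibleModPGaloisRep_of_torsionIso_symm e he hirr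
  exact certificate_of_torsionIso hEPW h5 hlev A W p hp hgoodA hordA hirrA hgood hord ⟨e, he⟩ fA hfA
    f hf hcertA

/-- **Conversely, the crux supplies a certified partner for every X9 pair — the pair itself** (at the
newform given by modularity, `hmodP`): `AnalyticMuZeroX9` ⟹ «every X9 pair has a certified
good-ordinary `p`-congruent partner». [cite: BCDTJAMS2001, Thm. A] -/
theorem forall_exists_certifiedPartner_of_analyticMuZeroX9
    (hmodP : nonempty_modularParametrizationData)
    (hA : Summit.BirchSwinnertonDyer.BirchSwinnertonDyer.Theses.SmallImageMuTransfer.AnalyticMuZeroX9) :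
    ∀ (W : WeierstrassCurve ℚ) [W.IsElliptic] [W.IsGloballyMinimal] (p : ℕ) [Fact p.Prime],
      ClassX9 W p →
      ∃ (A : WeierstrassCurve ℚ) (_ : A.IsElliptic) (_ : A.IsGloballyMinimal),
        A.HasGoodReductionAtPrime p ∧ ¬ (p : ℤ) ∣ A.frobeniusTrace p ∧
        (∃ e : geomTorsion A (p : ℤ) ≃+ geomTorsion W (p : ℤ),
          ∀ (σ : Field.absoluteGaloisGroup ℚ) (P : geomTorsion A (p : ℤ)), e (σ • P) = σ • e P) ∧
        ∃ (N : ℕ) (_ : NeZero N) (fA : CuspForm (Gamma0 N) 2), IsNewformOf A fA ∧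
          ∃ n : ℕ, ‖PowerSeries.coeff n (padicLFunction fA (unitRoot A p : ℚ_[p]))‖ = 1 := by
  intro W _ _ p _ hX9
  obtain ⟨-, -, hgood, hord, -, -⟩ := id hX9
  haveI : NeZero (W.conductorNorm ℤ) := ⟨(W.conductorNorm_pos_holds).ne'⟩
  obtain ⟨Dm⟩ := hmodP W
  refine ⟨W, ‹_›, ‹_›, hgood, hord, ⟨AddEquiv.refl _, fun σ P => rfl⟩, W.conductorNorm ℤ, ‹_›, Dm.f,
    Dm.isNewformOf, ?_⟩
  unfold Summit.BirchSwinnertonDyer.BirchSwinnertonDyer.Theses.SmallImageMuTransfer.AnalyticMuZeroX9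
    AnalyticMuZeroOnClassX9 at hA
  exact hA W p Dm.f hX9 Dm.isNewformOf

/-- **The congruence road, class-wide, is EXACTLY the crux.** Modulo EPW 2006 Thm. 1 (`hEPW`), the
period unit (`h5`), Carayol (`hlev`) and modularity (`hmodP`):
`Theses.SmallImageMuTransfer.AnalyticMuZeroX9 ↔ «every X9 pair has a certified good-ordinary
p-congruent partner»`. The road re-indexes Greenberg's analytic `μ = 0` on X9 by residual
representation (one certificate per `ρ̄`, transported by EPW) and does not weaken it; the residual
crux of any route built on this road is stmt-19630 itself. [cite: EmertonPollackWeston2006, Thm. 1 (arXiv:math/0404484 p. 2)]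
[cite: GreenbergLNM1716, §1 Conj. 1.11] -/
theorem analyticMuZeroX9_iff_forall_exists_certifiedPartner
    (hEPW : EmertonPollackWeston2006.thm1_muAn_transfer_of_torsionIso)
    (h5 : realPeriodRat_eq_unit_mul_plusPeriod)
    (hlev : ∀ (N : ℕ) [NeZero N], IsNewformOf.level_eq_conductorNorm (N := N))
    (hmodP : nonempty_modularParametrizationData) :
    Summit.BirchSwinnertonDyer.BirchSwinnertonDyer.Theses.SmallImageMuTransfer.AnalyticMuZeroX9 ↔
    ∀ (W : WeierstrassCurve ℚ) [W.IsElliptic] [W.IsGloballyMinimal] (p : ℕ) [Fact p.Prime],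
      ClassX9 W p →
      ∃ (A : WeierstrassCurve ℚ) (_ : A.IsElliptic) (_ : A.IsGloballyMinimal),
        A.HasGoodReductionAtPrime p ∧ ¬ (p : ℤ) ∣ A.frobeniusTrace p ∧
        (∃ e : geomTorsion A (p : ℤ) ≃+ geomTorsion W (p : ℤ),
          ∀ (σ : Field.absoluteGaloisGroup ℚ) (P : geomTorsion A (p : ℤ)), e (σ • P) = σ • e P) ∧
        ∃ (N : ℕ) (_ : NeZero N) (fA : CuspForm (Gamma0 N) 2), IsNewformOf A fA ∧
          ∃ n : ℕ, ‖PowerSeries.coeff n (padicLFunction fA (unitRoot A p : ℚ_[p]))‖ = 1 :=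
  ⟨forall_exists_certifiedPartner_of_analyticMuZeroX9 hmodP,
    analyticMuZeroX9_of_forall_exists_certifiedPartner hEPW h5 hlev⟩

/-- **The same with the facts packaged as the route's own items** `MuSplitInputs` (stmt-19236: EPW Thm.
1 ∧ period unit ∧ Carayol) and `ModularParametrizationSupply` (stmt-19266): the crux `AnalyticMuZeroX9`
is equivalent to the certified-partner hypothesis. Not a route edit; a kernel display.
[cite: EmertonPollackWeston2006, Thm. 1 (arXiv:math/0404484 p. 2)] [cite: GreenbergLNM1716, §1 Conj. 1.11] -/
theorem analyticMuZeroX9_iff_forall_exists_certifiedPartner_of_muSplitInputs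
    (hIn : Summit.BirchSwinnertonDyer.BirchSwinnertonDyer.Theses.SmallImageMuTransfer.MuSplitInputs)
    (hmod : Summit.BirchSwinnertonDyer.BirchSwinnertonDyer.Theses.SmallImageMuTransfer.ModularParametrizationSupply) :
    Summit.BirchSwinnertonDyer.BirchSwinnertonDyer.Theses.SmallImageMuTransfer.AnalyticMuZeroX9 ↔
    ∀ (W : WeierstrassCurve ℚ) [W.IsElliptic] [W.IsGloballyMinimal] (p : ℕ) [Fact p.Prime],
      ClassX9 W p →
      ∃ (A : WeierstrassCurve ℚ) (_ : A.IsElliptic) (_ : A.IsGloballyMinimal),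
        A.HasGoodReductionAtPrime p ∧ ¬ (p : ℤ) ∣ A.frobeniusTrace p ∧
        (∃ e : geomTorsion A (p : ℤ) ≃+ geomTorsion W (p : ℤ),
          ∀ (σ : Field.absoluteGaloisGroup ℚ) (P : geomTorsion A (p : ℤ)), e (σ • P) = σ • e P) ∧
        ∃ (N : ℕ) (_ : NeZero N) (fA : CuspForm (Gamma0 N) 2), IsNewformOf A fA ∧
          ∃ n : ℕ, ‖PowerSeries.coeff n (padicLFunction fA (unitRoot A p : ℚ_[p]))‖ = 1 := by
  obtain ⟨hEPW, h5, hlev⟩ := hIn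
  exact analyticMuZeroX9_iff_forall_exists_certifiedPartner hEPW h5 hlev hmod

end Summit.BirchSwinnertonDyer.BirchSwinnertonDyer.Rank1Residual

end
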